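import Summits.NavierStokesRegularity.FunctionalMining.HyperdissipativeSobolev
import Literature.Analysis.FunctionSpaces.TorusEnstrophyTrilinear
import HarnessLib
/-!
# FunctionalMining — the located gap of the enstrophy in hyperdissipative units: the vortex
# stretching is absorbed at J.-L. Lions' exponent `α = 5/4` (static form)

Search for candidate a priori estimates; no regularity claim. Cell `pub-nsfunc`, prove seat
(gen 25). Kernel form (part 2 of 2; part 1 = `HyperdissipativeSobolev.lean`) of the prove seat's paper
fragment `estimates.tex` Prop. "fragments with honest scope" (d): for the hyperdissipative model
`∂ₜu + P(u·∇)u = −ν Λ^{2α} u`, `Λ = (−Δ)^{1/2}`, the enstrophy `Y = ‖∇u‖₂²` obeys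
`dY/dt = 2σ − 2ν‖Λ^α ∇u‖₂²` with the vortex stretching `σ = −∫⟪(u·∇)u, Δu⟫`, and at `α = 5/4` the
stretching is absorbed — on `T³ = UnitAddTorus (Fin 3)`, with `fracGradPairing θ u = ‖Λ^θ∇u‖₂²`:

* **`abs_integral_inner_convect_laplacian_le_fracGradPairing`** —
  `|∫⟪(u·∇)u, Δu⟫| ≤ C ‖∇u‖₂ ‖Λ^{3/4}∇u‖₂²` for smooth divergence-free `u` (cubic density
  `≤ 9|∇u|³`, Cauchy–Schwarz, `Ḣ^{3/4} ⊂ L⁴` of part 1);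
* **`two_mul_abs_stretching_le_hyperdissipation`** — for every `ν > 0`:
  `2|∫⟪(u·∇)u, Δu⟫| ≤ ν ‖Λ^{5/4}∇u‖₂² + (C/ν) ‖∇u‖₂² ‖Λ^{1/4}∇u‖₂²`; here
  `‖Λ^{1/4}∇u‖₂² = ‖Λ^{5/4}u‖₂²` (part 1, `fracGradPairing_quarter_eq`) is the energy-dissipation
  rate of the `α = 5/4` model, whose time integral is bounded by the initial kinetic energy — so the
  budget is Grönwall-closable: `Y(t) ≤ Y(0) exp(C K(0)/ν²)` along the model (the dynamic statement
  is not in this file).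

LOCATED GAP (one line): true Navier–Stokes is `α = 1`, where the same chain gives only
`|σ| ≤ K ‖∇u‖₂^{3/2}‖Δu‖₂^{3/2}` (tree `Torus.abs_integral_inner_convect_laplacian_le`), whose Young
form `(ν/2)‖Δu‖₂² + (8K⁴/ν³)Y³` (`…_le_dissipation`) is NOT Grönwall-closable; the gap is `α = 1`
versus `5/4` (sharp for weak solutions: Luo–Titi 2020, tree
`Literature/Barriers/NavierStokesRegularity/LionsExponentSharpness`). Constants existential.
Context (not restated): J.-L. Lions, *Quelques méthodes de résolution des problèmes aux limites non
linéaires* (1969), Ch. I §6, Rem. 6.11 — global regularity of the model for `α ≥ 5/4`. [ours]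
-/
noncomputable section

open MeasureTheory Set Filter Topology Finset
open scoped InnerProductSpace

namespace Summit.NavierStokesRegularity.FunctionalMining

namespace HyperNS

open Literature.Analysis.FunctionSpaces Literature.Analysis.FunctionSpaces.Torus
open Literature.Analysis.FluidPDE Literature.Analysis.FluidPDE.Torus
/-! ## 1. The vortex stretching against `‖∇u‖₂ ‖Λ^{3/4}∇u‖₂²` -/

/-- **`|∫⟪(u·∇)u, Δu⟫| ≤ C ‖∇u‖₂ ‖Λ^{3/4}∇u‖₂²` on `T³`:** there is `C ≥ 0` such that for every
smooth divergence-free `u`,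
`|∫ ⟪(u·∇)u, Δu⟫| ≤ C · (gradNormSq u)^{1/2} · fracGradPairing (3/4) u`. Proof: the tree identity
`∫⟪Δu,(u·∇)u⟫ = −∫∑∑(∂ₘu)ᵢ⟪∂ₘu,∂ᵢu⟫` (`Torus.integral_inner_laplacian_convect_self_eq_neg`), the
pointwise bound `9|∇u|²√(|∇u|²)` of the cubic density, Cauchy–Schwarz `∫θ√θ ≤ √(∫θ²)·√(∫θ)`, and
part 1. (Compare the tree's Navier–Stokes version `Torus.abs_integral_inner_convect_laplacian_le`:
`K ‖∇u‖₂^{3/2}‖Δu‖₂^{3/2}` via Ladyzhenskaya.) [ours] -/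
theorem abs_integral_inner_convect_laplacian_le_fracGradPairing :
    ∃ C : ℝ, 0 ≤ C ∧ ∀ u : UnitAddTorus (Fin 3) → EuclideanSpace ℝ (Fin 3), Torus.IsSmooth u →
      Torus.IsDivFree u →
      |∫ x, ⟪Torus.convect u u x, Torus.laplacian u x⟫_ℝ| ≤
        C * Torus.gradNormSq u ^ (1 / 2 : ℝ) * fracGradPairing (3 / 4) u := by
  obtain ⟨C₀, hC₀0, hC₀⟩ := exists_integral_gradSq_sq_le_fracGradPairing_sq
  refine ⟨9 * Real.sqrt C₀, by positivity, fun u hu hdiv => ?_⟩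
  set E : ℝ := Torus.gradNormSq u with hE
  have hE0 : 0 ≤ E := Torus.gradNormSq_nonneg u
  set θ : UnitAddTorus (Fin 3) → ℝ := fun x => ∑ m, ‖Torus.partialDeriv m u x‖ ^ 2 with hθdef
  have hθ0 : ∀ x, 0 ≤ θ x := fun x => Finset.sum_nonneg fun m _ => sq_nonneg _
  have hDs : ∀ m, Torus.IsSmooth (Torus.partialDeriv m u) := fun m => hu.partialDeriv m
  have hcθ : Continuous θ := continuous_finsetSum _ fun m _ => (hDs m).continuous.norm.pow 2
  have hEθ : ∫ x, θ x = E := rfl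
  have hP0 : 0 ≤ fracGradPairing (3 / 4) u := fracGradPairing_nonneg (by norm_num) hu
  -- Step 1: `|∫ ⟪(u·∇)u, Δu⟫| ≤ 9 ∫ θ √θ`
  have hcubic_cont : Continuous fun x => ∑ m, ∑ i, Torus.partialDeriv m u x i *
      ⟪Torus.partialDeriv m u x, Torus.partialDeriv i u x⟫_ℝ :=
    continuous_finsetSum _ fun m _ => continuous_finsetSum _ fun i _ =>
      (((hDs m).apply i).continuous).mul (((hDs m).continuous).inner ((hDs i).continuous))
  have hstep1 : |∫ x, ⟪Torus.convect u u x, Torus.laplacian u x⟫_ℝ| ≤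
      9 * ∫ x, θ x * Real.sqrt (θ x) := by
    have hcomm : ∫ x, ⟪Torus.convect u u x, Torus.laplacian u x⟫_ℝ =
        ∫ x, ⟪Torus.laplacian u x, Torus.convect u u x⟫_ℝ :=
      integral_congr_ae (ae_of_all _ fun x => real_inner_comm _ _)
    rw [hcomm, Torus.integral_inner_laplacian_convect_self_eq_neg hu hdiv, abs_neg]
    calc |∫ x, ∑ m, ∑ i, Torus.partialDeriv m u x i *
          ⟪Torus.partialDeriv m u x, Torus.partialDeriv i u x⟫_ℝ|
        ≤ ∫ x, |∑ m, ∑ i, Torus.partialDeriv m u x i *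
          ⟪Torus.partialDeriv m u x, Torus.partialDeriv i u x⟫_ℝ| := abs_integral_le_integral_abs
      _ ≤ ∫ x, (Fintype.card (Fin 3) : ℝ) ^ 2 * θ x * Real.sqrt (θ x) :=
          integral_mono hcubic_cont.abs.integrable_unitAddTorus
            (((continuous_const.mul hcθ).mul hcθ.sqrt).integrable_unitAddTorus)
            fun x => Torus.abs_sum_partialDeriv_mul_inner_le u x
      _ = 9 * ∫ x, θ x * Real.sqrt (θ x) := by
          rw [← integral_const_mul]
          refine integral_congr_ae (ae_of_all _ fun x => ?_)
          simp only [Fintype.card_fin, Nat.cast_ofNat]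
          ring
  -- Step 2: Cauchy–Schwarz, `∫ θ √θ ≤ √(∫ θ²) · √E`
  have hstep2 : ∫ x, θ x * Real.sqrt (θ x) ≤ Real.sqrt (∫ x, θ x ^ 2) * Real.sqrt E := by
    have hf : MemLp θ (ENNReal.ofReal 2) volume :=
      hcθ.memLp_of_hasCompactSupport (HasCompactSupport.of_compactSpace θ)
    have hg : MemLp (fun x => Real.sqrt (θ x)) (ENNReal.ofReal 2) volume :=
      hcθ.sqrt.memLp_of_hasCompactSupport (HasCompactSupport.of_compactSpace _)
    have h := integral_mul_le_Lp_mul_Lq_of_nonneg (μ := volume) Real.HolderConjugate.two_two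
      (ae_of_all _ hθ0) (ae_of_all _ fun x => Real.sqrt_nonneg (θ x)) hf hg
    have e1 : ∫ x, θ x ^ (2 : ℝ) = ∫ x, θ x ^ 2 :=
      integral_congr_ae (ae_of_all _ fun x => Real.rpow_two _)
    have e2 : ∫ x, Real.sqrt (θ x) ^ (2 : ℝ) = E := by
      rw [← hEθ]
      exact integral_congr_ae (ae_of_all _ fun x => by simp only [Real.rpow_two, Real.sq_sqrt (hθ0 x)])
    rw [e1, e2] at h
    rw [Real.sqrt_eq_rpow, Real.sqrt_eq_rpow]
    exact h
  -- Step 3: `√(∫θ²) ≤ √C₀ · ‖Λ^{3/4}∇u‖₂²`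
  have hstep3 : Real.sqrt (∫ x, θ x ^ 2) ≤ Real.sqrt C₀ * fracGradPairing (3 / 4) u := by
    calc Real.sqrt (∫ x, θ x ^ 2) ≤ Real.sqrt (C₀ * fracGradPairing (3 / 4) u ^ 2) :=
          Real.sqrt_le_sqrt (hC₀ u hu)
      _ = Real.sqrt C₀ * fracGradPairing (3 / 4) u := by
          rw [Real.sqrt_mul hC₀0, Real.sqrt_sq hP0]
  have hsqrtE : Real.sqrt E = E ^ (1 / 2 : ℝ) := Real.sqrt_eq_rpow E
  calc |∫ x, ⟪Torus.convect u u x, Torus.laplacian u x⟫_ℝ|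
      ≤ 9 * ∫ x, θ x * Real.sqrt (θ x) := hstep1
    _ ≤ 9 * (Real.sqrt (∫ x, θ x ^ 2) * Real.sqrt E) := by gcongr
    _ ≤ 9 * (Real.sqrt C₀ * fracGradPairing (3 / 4) u * Real.sqrt E) := by gcongr
    _ = 9 * Real.sqrt C₀ * E ^ (1 / 2 : ℝ) * fracGradPairing (3 / 4) u := by
        rw [hsqrtE]; ring
/-! ## 2. The Grönwall-closable budget at Lions' exponent `α = 5/4` -/

/-- **The stretching is absorbed by `Λ^{5/2}`-dissipation (J.-L. Lions' exponent `α = 5/4`), static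
form.** There is `C ≥ 0` such that for every smooth divergence-free `u` on `T³` and every `ν > 0`:
`2 |∫ ⟪(u·∇)u, Δu⟫| ≤ ν · ‖Λ^{5/4}∇u‖₂² + (C/ν) · ‖∇u‖₂² · ‖Λ^{1/4}∇u‖₂²`, i.e.
`≤ ν · fracGradPairing (5/4) u + (C/ν) · gradNormSq u · fracGradPairing (1/4) u`.
Along the hyperdissipative model `∂ₜu + P(u·∇)u = −νΛ^{5/2}u` the left side is the production of
`‖∇u‖₂²`, the first term is half its dissipation `2ν‖Λ^{5/4}∇u‖₂²`, and `‖Λ^{1/4}∇u‖₂² = ‖Λ^{5/4}u‖₂²`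
(`fracGradPairing_quarter_eq_tsum`) is the model's energy-dissipation rate, time-integrable by the
energy identity — so the budget closes by Grönwall. For Navier–Stokes (`α = 1`) the analogous
chain is NOT closable (tree `Torus.abs_integral_inner_convect_laplacian_le_dissipation`); located gap
`α = 1` vs `5/4`. [ours] -/
theorem two_mul_abs_stretching_le_hyperdissipation :
    ∃ C : ℝ, 0 ≤ C ∧ ∀ u : UnitAddTorus (Fin 3) → EuclideanSpace ℝ (Fin 3), Torus.IsSmooth u →
      Torus.IsDivFree u → ∀ {ν : ℝ}, 0 < ν →
      2 * |∫ x, ⟪Torus.convect u u x, Torus.laplacian u x⟫_ℝ| ≤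
        ν * fracGradPairing (5 / 4) u + C / ν * Torus.gradNormSq u * fracGradPairing (1 / 4) u := by
  obtain ⟨C₂, hC₂0, hC₂⟩ := abs_integral_inner_convect_laplacian_le_fracGradPairing
  refine ⟨C₂ ^ 2, sq_nonneg _, fun u hu hdiv ν hν => ?_⟩
  set E : ℝ := Torus.gradNormSq u with hE
  have hE0 : 0 ≤ E := Torus.gradNormSq_nonneg u
  have hP1 : 0 ≤ fracGradPairing (1 / 4) u := fracGradPairing_nonneg (by norm_num) hu
  have hP3 : 0 ≤ fracGradPairing (3 / 4) u := fracGradPairing_nonneg (by norm_num) hu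
  have hP5 : 0 ≤ fracGradPairing (5 / 4) u := fracGradPairing_nonneg (by norm_num) hu
  have h1 := hC₂ u hu hdiv
  set A : ℝ := C₂ * E ^ (1 / 2 : ℝ) with hA
  have hA0 : 0 ≤ A := mul_nonneg hC₂0 (Real.rpow_nonneg hE0 _)
  have hAsq : A ^ 2 = C₂ ^ 2 * E := by
    rw [hA, mul_pow, ← Real.rpow_natCast (E ^ (1 / 2 : ℝ)) 2, ← Real.rpow_mul hE0]
    norm_num
  have hRHS0 : 0 ≤ ν * fracGradPairing (5 / 4) u + C₂ ^ 2 / ν * E * fracGradPairing (1 / 4) u := by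
    positivity
  rcases hA0.eq_or_lt with hA00 | hApos
  · -- degenerate case `C₂ √E = 0`: the stretching bound is `0`
    have : |∫ x, ⟪Torus.convect u u x, Torus.laplacian u x⟫_ℝ| ≤ 0 := by
      calc _ ≤ A * fracGradPairing (3 / 4) u := h1
        _ = 0 := by rw [← hA00, zero_mul]
    linarith
  · -- `ε := ν / A`
    have hε : 0 < ν / A := div_pos hν hApos
    have h2 := fracGradPairing_threeQuarter_le hu hε
    have h3 : 2 * |∫ x, ⟪Torus.convect u u x, Torus.laplacian u x⟫_ℝ| ≤
        2 * (A * fracGradPairing (3 / 4) u) := by linarith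
    have h4 : 2 * (A * fracGradPairing (3 / 4) u) ≤
        A * (ν / A * fracGradPairing (5 / 4) u + (ν / A)⁻¹ * fracGradPairing (1 / 4) u) := by
      have := mul_le_mul_of_nonneg_left h2 hA0
      linarith
    have hAne : A ≠ 0 := hApos.ne'
    have e5 : A * (ν / A * fracGradPairing (5 / 4) u + (ν / A)⁻¹ * fracGradPairing (1 / 4) u) =
        ν * fracGradPairing (5 / 4) u + A ^ 2 / ν * fracGradPairing (1 / 4) u := by
      field_simp
    rw [e5, hAsq] at h4
    calc _ ≤ _ := h3
      _ ≤ _ := h4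
      _ = _ := by ring
end HyperNS

end Summit.NavierStokesRegularity.FunctionalMining

end
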